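import Summits.Ventures.PercRepro.RankLevelSetIndepCD

/-! # RankLevelSetIndepCDMinor — (★★) FOR THE MINORS `(M / W) | (V ∪ {e})` IMPLIES (CD) (night-1 g27; dossier §39.6)

`RankLevelSetIndepCD` proved `indepCD_of_relPerElemMid : RelPerElemMid M → IndepCD M`, where the relative near-middle
inequality `RelPerElemMid M` compares, for disjoint `W, V ⊆ E ∖ {e}` with `#V = 2j + 1`, the `(j+1)`- and `j`-fibres
`fibreSets M e W V m = {A₀ ⊆ V : #A₀ = m, W ∪ A₀ ∪ {e} and W ∪ (V ∖ A₀) independent}`. Here the two fibres are identified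
with the marked bi-independent counts of the MINOR `N = (M / W) | (V ∪ {e})` (a matroid on `2j + 2` elements) at `e`:
* `yThroughCount_minor_eq`: `a_j(N; e) = #fibreSets M e W V j` (`Q ↦ Q ∖ {e}`; `N.Indep X ↔ Disjoint X W ∧ M.Indep (X ∪ W)`
  for independent `W`, `Indep.contract_indep_iff` and `restrict_indep_iff`),
* `yAvoidCount_minor_eq`: `b_j(N; e) = #fibreSets M e W V (j + 1)` (`Z ↦ V ∖ Z`),
so `RelPerElemMid M` is exactly (★★) at level `j` (`2j + 1 < 2j + 2`) for every such minor, a dependent `W` giving empty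
fibres (`relPerElemMid_of_perElem_minors`), and **`indepCD_of_perElem_minors`**: if every minor `(M / W) | (V ∪ {e})`
satisfies (★★) (`BiIndepPerElem`), then `M` satisfies (CD). Nothing here asserts (★★) or (CD); every declaration has a
docstring; imports: the cell's own modules and Mathlib only. Axioms: standard. -/

namespace PercRepro

open Set Matroid Finset

variable {α : Type} {M : Matroid α} [M.Finite]

/-! ## The relative inequality IS (★★) for the minor `(M / W) | (V ∪ {e})` -/

section Minor

/-- The minor `(M / W) | (V ∪ {e})` of a finite matroid is finite. -/
lemma minor_finite (W V : Set α) (e : α) (hV : V ⊆ M.E) : ((M ／ W) ↾ (V ∪ {e})).Finite :=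
  ⟨by rw [restrict_ground_eq]; exact (M.ground_finite.subset hV).union (Set.finite_singleton e)⟩

omit [M.Finite] in
/-- Independence in the minor `(M / W) | R` for independent `W`: `Disjoint X W`, `M.Indep (X ∪ W)` and `X ⊆ R`. -/
lemma minor_indep_iff {W R X : Set α} (hW : M.Indep W) :
    ((M ／ W) ↾ R).Indep X ↔ (Disjoint X W ∧ M.Indep (X ∪ W)) ∧ X ⊆ R := by
  rw [restrict_indep_iff, hW.contract_indep_iff]

omit [M.Finite] in
/-- A subset of `V` is disjoint from `W` when `W` and `V` are. -/
lemma disjoint_of_subset_right' {W V X : Set α} (hdisj : Disjoint W V) (hX : X ⊆ V) : Disjoint X W :=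
  (hdisj.mono_right hX).symm

/-- **The through-`e` count of the minor is the `j`-fibre**: `a_j((M / W) | (V ∪ {e}); e) = #fibreSets M e W V j` for
independent `W ⊆ E ∖ {e}` and `V ⊆ E ∖ {e}` disjoint from `W` (by `Q ↦ Q ∖ {e}`). -/
lemma yThroughCount_minor_eq {W V : Set α} {e : α} (hW : M.Indep W) (hWE : W ⊆ M.E \ {e})
    (hVE : V ⊆ M.E \ {e}) (hdisj : Disjoint W V) (j : ℕ) :
    yThroughCount ((M ／ W) ↾ (V ∪ {e})) e j = (fibreSets M e W V j).ncard := by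
  have heV : e ∉ V := fun h => (hVE h).2 rfl
  have heW : e ∉ W := fun h => (hWE h).2 rfl
  have hVfin : V.Finite := M.ground_finite.subset (hVE.trans Set.sdiff_subset)
  have hVe : (V ∪ {e}).Finite := hVfin.union (Set.finite_singleton e)
  unfold yThroughCount fibreSets
  refine Set.ncard_congr (fun Q _ => Q \ {e}) ?_ ?_ ?_
  · rintro Q ⟨⟨hQE, hQcard, hQind, hQcind⟩, heQ⟩
    rw [restrict_ground_eq] at hQE hQcind
    rw [minor_indep_iff hW] at hQind hQcind
    have hA₀V : Q \ {e} ⊆ V := by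
      intro x hx
      rcases hQE hx.1 with h | h
      · exact h
      · exact absurd h hx.2
    have hQeq : insert e (Q \ {e}) = Q := Set.insert_sdiff_singleton.trans (Set.insert_eq_of_mem heQ)
    refine ⟨hA₀V, ?_, ?_, ?_⟩
    · rw [Set.ncard_sdiff_singleton_of_mem heQ, hQcard]
      rfl
    · have h1 : insert e (W ∪ (Q \ {e})) = Q ∪ W := by
        rw [Set.union_comm W, ← Set.insert_union, hQeq]
      rw [h1]; exact hQind.1.2
    · have h2 : (V ∪ {e}) \ Q = V \ (Q \ {e}) := by
        ext x
        simp only [Set.mem_sdiff, Set.mem_union, Set.mem_singleton_iff]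
        constructor
        · rintro ⟨hx | hx, hxQ⟩
          · exact ⟨hx, fun h => hxQ h.1⟩
          · exact absurd (hx ▸ heQ) hxQ
        · rintro ⟨hxV, hx⟩
          refine ⟨Or.inl hxV, fun hxQ => hx ⟨hxQ, fun hxe => heV (hxe ▸ hxV)⟩⟩
      rw [h2] at hQcind
      rw [Set.union_comm]; exact hQcind.1.2
  · rintro Q Q' ⟨-, heQ⟩ ⟨-, heQ'⟩ hQQ'
    have e1 : Q = insert e (Q \ {e}) := (Set.insert_sdiff_singleton.trans (Set.insert_eq_of_mem heQ)).symm
    have e2 : Q' = insert e (Q' \ {e}) := (Set.insert_sdiff_singleton.trans (Set.insert_eq_of_mem heQ')).symm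
    rw [e1, e2, hQQ']
  · rintro A₀ ⟨hA₀V, hA₀card, hind₁, hind₂⟩
    have heA₀ : e ∉ A₀ := fun h => heV (hA₀V h)
    refine ⟨insert e A₀, ⟨?_, Set.mem_insert e A₀⟩, ?_⟩
    simp only [biIndep, Set.mem_setOf_eq]
    refine ⟨?_, ?_, ?_, ?_⟩
    · rw [restrict_ground_eq]
      exact Set.insert_subset (Set.mem_union_right _ (Set.mem_singleton e)) (hA₀V.trans Set.subset_union_left)
    · rw [Set.ncard_insert_of_notMem heA₀ (hVfin.subset hA₀V), hA₀card]
    · rw [minor_indep_iff hW]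
      refine ⟨⟨?_, ?_⟩, Set.insert_subset (Set.mem_union_right _ (Set.mem_singleton e))
        (hA₀V.trans Set.subset_union_left)⟩
      · rw [Set.disjoint_left]
        rintro x hx hxW
        rcases Set.mem_insert_iff.mp hx with rfl | hxA
        · exact heW hxW
        · exact (Set.disjoint_left.mp hdisj hxW) (hA₀V hxA)
      · have h1 : insert e A₀ ∪ W = insert e (W ∪ A₀) := by
          rw [Set.insert_union, Set.union_comm]
        rw [h1]; exact hind₁
    · rw [restrict_ground_eq]
      have h2 : (V ∪ {e}) \ insert e A₀ = V \ A₀ := by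
        ext x
        simp only [Set.mem_sdiff, Set.mem_union, Set.mem_singleton_iff, Set.mem_insert_iff, not_or]
        constructor
        · rintro ⟨hx | hx, hxe, hxA⟩
          · exact ⟨hx, hxA⟩
          · exact absurd hx hxe
        · rintro ⟨hxV, hxA⟩
          exact ⟨Or.inl hxV, fun hxe => heV (hxe ▸ hxV), hxA⟩
      rw [h2, minor_indep_iff hW]
      exact ⟨⟨disjoint_of_subset_right' hdisj Set.sdiff_subset, by rw [Set.union_comm]; exact hind₂⟩,
        Set.sdiff_subset.trans Set.subset_union_left⟩
    · show insert e A₀ \ {e} = A₀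
      rw [Set.insert_sdiff_of_mem _ (Set.mem_singleton e), Set.sdiff_singleton_eq_self heA₀]

/-- **The avoid-`e` count of the minor is the `(j+1)`-fibre**: `b_j((M / W) | (V ∪ {e}); e) = #fibreSets M e W V (j+1)`
when `#V = 2j + 1` (by `Z ↦ V ∖ Z`). -/
lemma yAvoidCount_minor_eq {W V : Set α} {e : α} (hW : M.Indep W) (hWE : W ⊆ M.E \ {e})
    (hVE : V ⊆ M.E \ {e}) (hdisj : Disjoint W V) (j : ℕ) (hV : V.ncard = 2 * j + 1) :
    yAvoidCount ((M ／ W) ↾ (V ∪ {e})) e j = (fibreSets M e W V (j + 1)).ncard := by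
  have heV : e ∉ V := fun h => (hVE h).2 rfl
  have heW : e ∉ W := fun h => (hWE h).2 rfl
  have hVfin : V.Finite := M.ground_finite.subset (hVE.trans Set.sdiff_subset)
  unfold yAvoidCount fibreSets
  refine Set.ncard_congr (fun Z _ => V \ Z) ?_ ?_ ?_
  · rintro Z ⟨⟨hZE, hZcard, hZind, hZcind⟩, heZ⟩
    rw [restrict_ground_eq] at hZE hZcind
    rw [minor_indep_iff hW] at hZind hZcind
    have hZV : Z ⊆ V := by
      intro x hx
      rcases hZE hx with h | h
      · exact h
      · exact absurd (Set.mem_singleton_iff.mp h ▸ hx) heZ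
    have h2 : (V ∪ {e}) \ Z = insert e (V \ Z) := by
      ext x
      simp only [Set.mem_sdiff, Set.mem_union, Set.mem_singleton_iff, Set.mem_insert_iff]
      constructor
      · rintro ⟨hx | hx, hxZ⟩
        · exact Or.inr ⟨hx, hxZ⟩
        · exact Or.inl hx
      · rintro (rfl | ⟨hxV, hxZ⟩)
        · exact ⟨Or.inr rfl, heZ⟩
        · exact ⟨Or.inl hxV, hxZ⟩
    rw [h2] at hZcind
    refine ⟨Set.sdiff_subset, ?_, ?_, ?_⟩
    · rw [Set.ncard_sdiff hZV (hVfin.subset hZV), hZcard, hV]; omega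
    · have h1 : insert e (V \ Z) ∪ W = insert e (W ∪ (V \ Z)) := by
        rw [Set.insert_union, Set.union_comm]
      rw [← h1]; exact hZcind.1.2
    · rw [Set.sdiff_sdiff_cancel_left hZV, Set.union_comm]; exact hZind.1.2
  · rintro Z Z' ⟨⟨hZE, -, -, -⟩, heZ⟩ ⟨⟨hZE', -, -, -⟩, heZ'⟩ hZZ'
    rw [restrict_ground_eq] at hZE hZE'
    have hZV : Z ⊆ V := by
      intro x hx
      rcases hZE hx with h | h
      · exact h
      · exact absurd (Set.mem_singleton_iff.mp h ▸ hx) heZ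
    have hZV' : Z' ⊆ V := by
      intro x hx
      rcases hZE' hx with h | h
      · exact h
      · exact absurd (Set.mem_singleton_iff.mp h ▸ hx) heZ'
    have : V \ (V \ Z) = V \ (V \ Z') := by rw [hZZ']
    rwa [Set.sdiff_sdiff_cancel_left hZV, Set.sdiff_sdiff_cancel_left hZV'] at this
  · rintro A₀ ⟨hA₀V, hA₀card, hind₁, hind₂⟩
    refine ⟨V \ A₀, ⟨?_, fun h => heV h.1⟩, Set.sdiff_sdiff_cancel_left hA₀V⟩
    simp only [biIndep, Set.mem_setOf_eq]
    refine ⟨?_, ?_, ?_, ?_⟩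
    · rw [restrict_ground_eq]; exact Set.sdiff_subset.trans Set.subset_union_left
    · rw [Set.ncard_sdiff hA₀V (hVfin.subset hA₀V), hA₀card, hV]; omega
    · rw [minor_indep_iff hW]
      exact ⟨⟨disjoint_of_subset_right' hdisj Set.sdiff_subset, by rw [Set.union_comm]; exact hind₂⟩,
        Set.sdiff_subset.trans Set.subset_union_left⟩
    · rw [restrict_ground_eq]
      have h2 : (V ∪ {e}) \ (V \ A₀) = insert e A₀ := by
        ext x
        simp only [Set.mem_sdiff, Set.mem_union, Set.mem_singleton_iff, Set.mem_insert_iff, not_and, not_not]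
        constructor
        · rintro ⟨hx | hx, h⟩
          · exact Or.inr (h hx)
          · exact Or.inl hx
        · rintro (rfl | hxA)
          · exact ⟨Or.inr rfl, fun h => absurd h heV⟩
          · exact ⟨Or.inl (hA₀V hxA), fun _ => hxA⟩
      rw [h2, minor_indep_iff hW]
      refine ⟨⟨?_, ?_⟩, Set.insert_subset (Set.mem_union_right _ (Set.mem_singleton e))
        (hA₀V.trans Set.subset_union_left)⟩
      · rw [Set.disjoint_left]
        rintro x hx hxW
        rcases Set.mem_insert_iff.mp hx with rfl | hxA
        · exact heW hxW
        · exact (Set.disjoint_left.mp hdisj hxW) (hA₀V hxA)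
      · have h1 : insert e A₀ ∪ W = insert e (W ∪ A₀) := by
          rw [Set.insert_union, Set.union_comm]
        rw [h1]; exact hind₁

/-- **(★★) for the minors `(M / W) | (V ∪ {e})` gives the relative near-middle inequality.** When `W` is dependent
both fibres are empty; otherwise the two fibres are `b_j` and `a_j` of the minor (a matroid on `2j + 2` elements) and
(★★) at level `j` (`2j + 1 < 2j + 2`) is the claim. -/
theorem relPerElemMid_of_perElem_minors
    (h : ∀ (e : α) (W V : Set α), e ∈ M.E → W ⊆ M.E \ {e} → V ⊆ M.E \ {e} → Disjoint W V → M.Indep W →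
      BiIndepPerElem ((M ／ W) ↾ (V ∪ {e}))) : RelPerElemMid M := by
  intro e he W V hWE hVE hdisj j hV
  by_cases hW : M.Indep W
  · have hN := h e W V he hWE hVE hdisj hW
    have heV : e ∉ V := fun h => (hVE h).2 rfl
    have hVfin : V.Finite := M.ground_finite.subset (hVE.trans Set.sdiff_subset)
    have heN : e ∈ ((M ／ W) ↾ (V ∪ {e})).E := by
      rw [restrict_ground_eq]; exact Set.mem_union_right _ (Set.mem_singleton e)
    have hcard : ((M ／ W) ↾ (V ∪ {e})).E.ncard = 2 * j + 2 := by
      rw [restrict_ground_eq, Set.union_singleton, Set.ncard_insert_of_notMem heV hVfin, hV]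
    have hstar := hN e heN j (by omega)
    change yAvoidCount ((M ／ W) ↾ (V ∪ {e})) e j ≤ yThroughCount ((M ／ W) ↾ (V ∪ {e})) e j at hstar
    rwa [yAvoidCount_minor_eq hW hWE hVE hdisj j hV, yThroughCount_minor_eq hW hWE hVE hdisj j] at hstar
  · have hempty : ∀ m, fibreSets M e W V m = ∅ := by
      intro m
      ext A₀
      simp only [fibreSets, Set.mem_setOf_eq, Set.mem_empty_iff_false, iff_false, not_and]
      intro _ _ hind _
      exact hW (hind.subset (Set.subset_union_left.trans (Set.subset_insert e _)))
    rw [hempty, hempty]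

/-- **(★★) FOR THE MINORS IMPLIES (CD)** — the composite: `(∀ minors, BiIndepPerElem) → IndepCD M`. -/
theorem indepCD_of_perElem_minors
    (h : ∀ (e : α) (W V : Set α), e ∈ M.E → W ⊆ M.E \ {e} → V ⊆ M.E \ {e} → Disjoint W V → M.Indep W →
      BiIndepPerElem ((M ／ W) ↾ (V ∪ {e}))) : IndepCD M :=
  indepCD_of_relPerElemMid M (relPerElemMid_of_perElem_minors h)

end Minor

end PercRepro
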